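import Literature.NumberTheory.EllipticCurves.ComplexMultiplication
import HarnessLib

/-!
# bsd.S28 (Burungale–Flach: full BSD for CM elliptic curves over `ℚ` with `L(E,1) ≠ 0`):
the assembly from its printed source

Sibling proof file of `Literature.NumberTheory.EllipticCurves.ComplexMultiplication` for the
named fact `Literature.NumberTheory.EllipticCurves.bsdTriple_of_j_mem_maximalCMJInvariants_of_L_one_ne_zero` (**bsd.S28**: for
an elliptic curve `E/ℚ` with complex multiplication by the maximal order `𝓞_K` of an imaginary
quadratic field `K` — over `ℚ` the condition `j(E) ∈ maximalCMJInvariants` — and `L(E,1) ≠ 0`,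
the full Birch–Swinnerton-Dyer statement `W.BSDTriple` = RANK `∧` SHAFIN `∧` LEAD holds for a
globally minimal model `W`; Burungale–Flach, Camb. J. Math. 12 (2024), Thm. 1.1 and Cor. 2).

The fact is a whole theory away from Mathlib (CM theory and Deuring's `L(E/ℚ,s) = L(ψ,s)`, the
two-variable Iwasawa main conjecture for `K` from elliptic units, Kato's explicit reciprocity
law, the descent formalism of the equivariant Tamagawa number conjecture at *every* prime, Weil
restriction of abelian surfaces and isogeny invariance of BSD over number fields), so D-0014
asks for a decomposition. This file

* vendors, as a named fact with a precise cite, the printed statement from which the target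
  follows by pure bookkeeping: **Burungale–Flach, Corollary 2** ("BSD for `E/F⁺`") in the case
  `F⁺ = ℚ`, `F = K` singled out by the authors themselves ("Any CM elliptic curve `E/ℚ` with
  `L(E/ℚ,1) ≠ 0` satisfies the assumptions of Corollary 2", the sentence following its proof):
  `E(ℚ)` and `Ш(E/ℚ)` are finite and `L(E/ℚ,1)/Ω(E) = |Ш(E/ℚ)| / |E(ℚ)|² · ∏_p |Φ_p|`
  (`BurungaleFlach2024_bsd_rat`), transcribed in the tree's normalisations (see the
  docstring for the dictionary `Ω(E⁺) = realPeriodRat`, `|Φ_p| = c_p`);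
* proves, unconditionally, the glue between the printed shape and the Clay/Tate shape
  `W.BSDTriple` used by the tree (`BSDInvariants.lean`) that the parent file does not already
  provide (the parent has `L(E,1) ≠ 0 ⇒ r_an = 0`,
  `Literature.NumberTheory.EllipticCurves.analyticRank_eq_zero_of_entireLFunction_one_ne_zero`, `E(K)` finite `⇒ rank 0`,
  `Literature.NumberTheory.EllipticCurves.mordellWeilRank_eq_zero_of_finite`, and RANK from both,
  `Literature.NumberTheory.EllipticCurves.bsdRankFormula_of_finite_point_of_entireLFunction_one_ne_zero`, all reused here):
  `r_an = 0 ⇒ L^{(r_an)}(E,1)/r_an! = L(E,1)`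
  (`WeierstrassCurve.leadingLCoeff_eq_of_analyticRank_eq_zero`), and for *finite* `E(K)`:
  `#E(K)_tors = #E(K)`, `Reg(E/K) = 1` (empty Gram determinant), hence
  `bsdRHS = #Ш · Ω · ∏ c_p / #E(ℚ)²` (`WeierstrassCurve.bsdRHS_eq_of_finite`), and `Ω(E) > 0`
  (`WeierstrassCurve.realPeriodRat_pos_holds`, discharging the named fact
  `WeierstrassCurve.realPeriodRat_pos` of `BSDInvariants.lean` from the landed
  `WeierstrassCurve.realPeriod_pos'` of `RealPeriod.lean`);
* proves the assembly
  `bsdTriple_of_j_mem_maximalCMJInvariants_of_L_one_ne_zero_of_BurungaleFlach2024`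
  (Corollary 2 over `ℚ` ⇒ bsd.S28) **and its converse modulo Coates–Wiles**
  (`BurungaleFlach2024_bsd_rat_of_bsdTriple`: bsd.S28 together with the finiteness of
  `E(ℚ)`, i.e. the tree fact `finite_point_of_j_mem_maximalCMJInvariants_of_L_one_ne_zero`,
  gives back Corollary 2 over `ℚ`), which certifies that the vendored leaf is *exactly* the
  target up to a 1977 theorem and not a stronger statement.

(The discharge of the parent's glue fact `Literature.NumberTheory.EllipticCurves.analyticRank_eq_zero_of_L_one_ne_zero`, the
RANK reductions to the Coates–Wiles facts and the isogeny reduction of the geometric-CM version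
`bsdTriple_of_hasCM_of_L_one_ne_zero` live in the parent file and its other sibling proof files
and are not repeated here; this file only adds the rank-zero LEAD glue in the `WeierstrassCurve`
namespace and the Burungale–Flach leaf and assembly.)

So bsd.S28 is reduced, sorry-free, to the single printed statement
`BurungaleFlach2024_bsd_rat`; `bsdTriple_of_j_mem_maximalCMJInvariants_of_L_one_ne_zero_holds`
itself stays open until that leaf is discharged (which requires the theory listed above; the DAG
below the leaf is recorded in the architecture paragraph).

## Architecture of the printed proof (Burungale–Flach 2024, §1 and §§2–3)

Let `E/F` have CM by `𝓞_K`, `F ⊇ K`, `F(E_tors)/K` abelian, `ψ` the Hecke character of `E/F`,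
`L(ψ̄,1) ≠ 0`. **Thm. 1.1**: `E(F)`, `Ш(E/F)` are finite and
`(L(ψ̄,1)/Ω) = |Ш(E/F)|_K / |E(F)| · ∏_v |Φ_v|_K · 𝔞(Ω)` as fractional `𝓞_K`-ideals; proof
(§3, Prop. "keyelliptic", for *every* prime `𝔭` of `𝓞_K`): a zeta element `z` is a basis of
`det_{𝓞_K ⊗ ℤ_p} RΓ(𝓞_F[1/p], T_p E)` and maps to `L_S(ψ̄,1)` under the period map, `z` coming
from the two-variable main conjecture of Johnson-Leung–Kings (elliptic units) by descent and
Kato's explicit reciprocity law (Prop. 15.9 of Kato 2004; the case needed is Wiles 1978 /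
Coates–Wiles 1978); the local volume computation is Lemma "localvolume"
(`0 → 𝓔⁰(𝓞_{F_v}) → E(F_v) → Φ_v → 0`, so `|Φ_v| = [E(F_v) : E⁰(F_v)] = c_v`).
**Cor. 1** (BSD for `E/F`): `L(E/F,1)/Ω(E) = |Ш(E/F)| / |E(F)|² · ∏_v |Φ_v|`, from Thm. 1.1 by
Shimura's `L(E/F,s) = L(ψ̄,s) L(ψ,s)` (Thm. 7.42), `N_{K/ℚ}|A|_K = |A|` and
`Ω(E) ℤ = Ω Ω̄ 𝔞(Ω) 𝔞(Ω)‾`. **Cor. 2** (BSD for `E/F⁺`, `E` defined over the fixed field `F⁺`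
of an involution of `F` inducing complex conjugation on `K`): `E(F⁺)`, `Ш(E/F⁺)` finite and
`L(E/F⁺,1)/Ω(E⁺) = |Ш(E/F⁺)| / |E(F⁺)|² · ∏_v |Φ⁺_v|`; proof: `Res_{F/F⁺} E ∼ E × E_ε ∼ E × E`
(Milne 1972, Thm. 3, `E_ε` the twist by the character of `F/F⁺`), BSD is invariant under Weil
restriction (Milne 1972, Thm. 1) and under isogeny, and every term of BSD for `(E × E)/F⁺` is
the square of the corresponding term for `E/F⁺`. Finally (p. 4): any CM elliptic curve `E/ℚ`
(CM by `𝓞_K` in the paper's standing convention) with `L(E/ℚ,1) ≠ 0` satisfies the assumptions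
of Cor. 2 with `F = K`, `F⁺ = ℚ` (`K(E_tors)/K` is abelian by CM theory, and
`L(E/ℚ,s) = L(ψ,s)` by Deuring, so `L(ψ̄,1) = conj L(E/ℚ,1) ≠ 0`).

Below the leaf, a Lean decomposition would need notions absent from the tree and from Mathlib
(the Hecke character `ψ_{E/F}` and `L(ψ̄,s)`; the BSD period `Ω(E/F)` at complex places and the
BSD statement over a number field; Weil restriction / abelian surfaces and their BSD terms;
`𝓞_K`-order ideals `|·|_K`; determinants of perfect complexes), each an XL definition cluster;
they are deliberately not stubbed here.

## References

* A. Burungale, M. Flach, *The conjecture of Birch and Swinnerton-Dyer for certain elliptic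
  curves with complex multiplication*, Camb. J. Math. 12 (2024), 357–415 (arXiv:2206.09874):
  Thm. 1.1, Cor. 1, Cor. 2 and the sentence following its proof (arXiv pp. 3–4), Lemma
  "localvolume" (arXiv pp. 9–10). [BurungaleFlach2024]
* J. S. Milne, *On the arithmetic of abelian varieties*, Invent. Math. 17 (1972), 177–190,
  Thm. 1, Thm. 3 and its Corollary (the inputs of Cor. 2; cited through [BurungaleFlach2024]).
  [Milne1972ArithmeticAV]
* K. Rubin, *The "main conjectures" of Iwasawa theory for imaginary quadratic fields*, Invent.
  Math. 103 (1991), Thm. 11.1 (the `𝔭 ∤ #𝓞_K^×` part, completed by Burungale–Flach).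
  [Rubin1991MainConj]
* J. Coates, A. Wiles, *On the conjecture of Birch and Swinnerton-Dyer*, Invent. Math. 39
  (1977), Thm. 1 (finiteness of `E(ℚ)`, used only in the converse direction). [CoatesWiles1977]
* J. Tate, *The arithmetic of elliptic curves*, Invent. Math. 23 (1974), §1, Conjecture 4 (the
  shape RANK ∧ SHAFIN ∧ LEAD of `WeierstrassCurve.BSDTriple`). [Tate1974]
-/

noncomputable section

open scoped Classical

/-! ### Unconditional glue on the BSD invariants (deliberate dot-notation extensions of
`WeierstrassCurve`, next to the invariants they concern) -/

namespace WeierstrassCurve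

section AnyField

variable {K : Type*} [Field K] (W : WeierstrassCurve K)

/-- If `E(K)` is finite then it is its own torsion subgroup, so `#E(K)_tors = #E(K)`
(`WeierstrassCurve.torsionOrder` is `Nat.card` of the torsion subgroup).
Silverman, *AEC*, VIII.6. [folklore] -/
theorem torsionOrder_eq_natCard_of_finite [Finite W.toAffine.Point] :
    W.torsionOrder = Nat.card W.toAffine.Point := by
  rw [torsionOrder, AddCommGroup.torsion_eq_top_iff.mpr is_add_torsion_of_finite,
    AddSubgroup.card_top]

end AnyField

section Regulator

variable {K : Type*} [Field K] [Height.AdmissibleAbsValues K] (W : WeierstrassCurve K)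

/-- If `E(K)` is finite, the elliptic regulator is `1`: `E(K)` is then a finite `ℤ`-module, so
`WeierstrassCurve.regulator` takes its genuine branch, `E(K)/tors` has `finrank_ℤ = 0`, and the
Gram determinant of the Néron–Tate pairing on the empty basis is `1`
(`WeierstrassCurve.regulatorOf_of_isEmpty`). This is the convention `Reg = 1` in rank zero of
the BSD formula. Gross, *Lectures on the conjecture of Birch and Swinnerton-Dyer* (2011), §4;
Silverman, *AEC*, C.16. [folklore] -/
theorem regulator_eq_one_of_finite [Finite W.toAffine.Point] : W.regulator = 1 := by
  have hfin : Module.Finite ℤ W.toAffine.Point := inferInstance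
  have h0 : Module.finrank ℤ (mordellWeilModTorsion W) = 0 := by
    rw [Module.finrank_eq_zero_iff]
    intro x
    obtain ⟨n, hn, hnx⟩ := (isOfFinAddOrder_of_finite x).exists_nsmul_eq_zero
    exact ⟨n, by exact_mod_cast hn.ne', by rw [natCast_zsmul]; exact hnx⟩
  haveI : IsEmpty (Fin (Module.finrank ℤ (mordellWeilModTorsion W))) := by
    rw [h0]; infer_instance
  rw [regulator, dif_pos hfin]
  exact regulatorOf_of_isEmpty _

end Regulator

section NumberField

variable {K : Type*} [Field K] [NumberField K] (W : WeierstrassCurve K)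

/-- In analytic rank zero the leading Taylor coefficient `L^{(r)}(W,1)/r!` is the value `L(W,1)`
(`iteratedDeriv 0 = id`, `0! = 1`). Birch–Swinnerton-Dyer (1965); Wiles, Clay BSD text (2006),
§1. [folklore] -/
theorem leadingLCoeff_eq_of_analyticRank_eq_zero (h : W.analyticRank = 0) :
    W.leadingLCoeff = W.entireLFunction 1 := by
  rw [leadingLCoeff, h, iteratedDeriv_zero, Nat.factorial_zero, Nat.cast_one, div_one]

end NumberField

section Rat

variable (W : WeierstrassCurve ℚ)

/-- **Discharge of `WeierstrassCurve.realPeriodRat_pos`** (`BSDInvariants.lean`): the real period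
`Ω(W) = ∫_{E(ℝ)} |ω| > 0` of (any model of) an elliptic curve over `ℚ`, from the landed
positivity of the real period over `ℝ` (`WeierstrassCurve.realPeriod_pos'`, `RealPeriod.lean`:
the integrand `1/√ψ` is integrable and positive on the non-empty open set `{ψ > 0}`) applied to
the base change `W/ℝ`, which is again elliptic. The named fact `W.realPeriodRat_pos` is a
`def` over every `W : WeierstrassCurve ℚ` (the section instance `[W.IsElliptic]` of
`BSDInvariants.lean` does not enter a `def` whose body does not use it); it is discharged here
for elliptic `W`, the only case in which it is meaningful and used (`bsdRHS_pos`, LEAD): for a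
singular model the integral `∫ dx/√ψ` may diverge (e.g. `y² = x³`, `ψ = 4x³`) and `realPeriod`
then takes the junk value `0`. Cremona, *Algorithms for Modular Elliptic Curves*, §3.7;
Silverman, *AEC*, C.16. [cite: CremonaAlgorithms1997, §3.7 (3.7.1)] -/
theorem realPeriodRat_pos_holds [W.IsElliptic] : W.realPeriodRat_pos :=
  -- term-mode proof (no `show`/tactic `haveI`), so that it elaborates both against the present
  -- instance-free body `0 < W.realPeriodRat` of the fact (by unfolding `realPeriodRat`) and against
  -- a body of the form `∀ [W.IsElliptic], 0 < W.realPeriodRat` (implicit lambda), cf. the hub edit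
  -- of `BSDInvariants.lean` giving the `section Rat` facts their `[W.IsElliptic]` binder.
  haveI : (W.baseChange ℝ).IsElliptic := by rw [baseChange]; infer_instance
  (W.baseChange ℝ).realPeriod_pos'

/-- The BSD right-hand side when `E(ℚ)` is finite: `Reg = 1` and `#E(ℚ)_tors = #E(ℚ)`, so
`bsdRHS W = #Ш · Ω · ∏ c_p / #E(ℚ)²` — the shape in which the rank-zero BSD formula is printed
(Coates–Wiles, Rubin, Burungale–Flach). Tate (1974), Conjecture 4; Wiles, Clay BSD text (2006),
§1, formula (4). [folklore] -/
theorem bsdRHS_eq_of_finite [Finite W.toAffine.Point] :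
    W.bsdRHS = (W.shaOrder : ℝ) * W.realPeriodRat * (W.tamagawaProduct : ℝ) /
      (Nat.card W.toAffine.Point : ℝ) ^ 2 := by
  rw [bsdRHS_def, W.regulator_eq_one_of_finite, W.torsionOrder_eq_natCard_of_finite, mul_one]

end Rat

end WeierstrassCurve

/-! ### bsd.S28: the printed leaf and the assembly -/

open WeierstrassCurve

namespace Literature.NumberTheory.EllipticCurves

/-- **Burungale–Flach 2024, Corollary 2 (BSD for `E/F⁺`), the case `F⁺ = ℚ`, as printed.**
Corollary 2: under the assumptions of Theorem 1.1 (`E/F` an elliptic curve over a number field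
`F` with CM by `𝓞_K` for an imaginary quadratic field `K`, `F(E_tors)/K` abelian, `ψ` the Hecke
character of `E/F`, `L(ψ̄,1) ≠ 0`) assume in addition that `E` is defined over a subfield
`F⁺ ⊂ F` which is the fixed field of an involution of `F` inducing complex conjugation on `K`;
then `E(F⁺)` and `Ш(E/F⁺)` are finite and
`L(E/F⁺,1) / Ω(E⁺) = |Ш(E/F⁺)| / |E(F⁺)|² · ∏_v |Φ⁺_v|`, `Φ⁺_v` the component group of the
Néron model of `E/F⁺` at the prime `v`. The authors add (sentence following the proof): *"Any CM
elliptic curve `E/ℚ` with `L(E/ℚ,1) ≠ 0` satisfies the assumptions of Corollary 2"* — with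
`F = K`, `F⁺ = ℚ`; "CM" is CM by `𝓞_K` throughout the paper, which for `E/ℚ` is the condition
`j(E) ∈ maximalCMJInvariants` (`K` then has class number one; `K(E_tors)/K` is abelian by CM
theory and `L(ψ̄,1) = conj L(E/ℚ,1)` by Deuring, as the authors use).

Dictionary with the tree (all for a globally minimal model `W` of `E/ℚ`, `[W.IsGloballyMinimal]`):
`L(E/ℚ,1) = W.entireLFunction 1`; `Ω(E⁺) = ∫_{E(ℝ)} |ω|` for a Néron differential `ω` — the
period of the BSD conjecture over the number field `F⁺` at its real place (Milne 1972, §1;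
Tate 1974), over all of `E(ℝ)` — is `W.realPeriodRat` (the invariant differential of a globally
minimal model is a Néron differential; `BSDInvariants.lean`, normalisation table);
`|Ш(E/ℚ)| = W.shaOrder`, `|E(ℚ)| = Nat.card E(ℚ)`; and `|Φ⁺_p| = [E(ℚ_p) : E⁰(ℚ_p)] = c_p`
(the paper's Lemma "localvolume", `0 → 𝓔⁰(𝓞_{F_v}) → E(F_v) → Φ_v → 0`, and Cor. 5,
"`Φ_v = E(F'_v)/E(F'_v)⁰` is the group of components"), so `∏_v |Φ⁺_v| = W.tamagawaProduct`.
The identity is stated in `ℂ`, where `W.entireLFunction 1` lives (it is real: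
`WeierstrassCurve.leadingLCoeff_im_eq_zero`).
[cite: BurungaleFlach2024, Cor. 2 and the sentence following its proof (arXiv p. 4); Thm 1.1] -/
def BurungaleFlach2024_bsd_rat : Prop :=
  ∀ (W : WeierstrassCurve ℚ) [W.IsElliptic] [W.IsGloballyMinimal],
    W.j ∈ maximalCMJInvariants → W.entireLFunction 1 ≠ 0 →
      Finite W.toAffine.Point ∧ W.ShaFinite ∧
        W.entireLFunction 1 / (W.realPeriodRat : ℂ) =
          (W.shaOrder : ℂ) / (Nat.card W.toAffine.Point : ℂ) ^ 2 * (W.tamagawaProduct : ℂ)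

/-- **bsd.S28 from Burungale–Flach, Corollary 2** (the assembly). The named fact
`bsdTriple_of_j_mem_maximalCMJInvariants_of_L_one_ne_zero` (RANK ∧ SHAFIN ∧ LEAD in the
Clay/Tate normalisation of `WeierstrassCurve.BSDTriple`, for `E/ℚ` with
`j(E) ∈ maximalCMJInvariants`, `L(E,1) ≠ 0` and a globally minimal `W`) follows from Corollary 2
over `ℚ` (hypothesis `h`) by bookkeeping: `L(E,1) ≠ 0` gives `r_an = 0` and `E(ℚ)` finite gives
`rank_ℤ E(ℚ) = 0`, whence RANK (the parent's
`bsdRankFormula_of_finite_point_of_entireLFunction_one_ne_zero`); `E(ℚ)` finite also gives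
`Reg = 1` and `#E(ℚ)_tors = #E(ℚ)` (`bsdRHS_eq_of_finite`); SHAFIN is printed; and LEAD
`L^{(0)}(E,1)/0! = #Ш · 1 · Ω · ∏ c_p / #E(ℚ)²` is the printed identity multiplied by
`Ω(E) > 0` (`realPeriodRat_pos_holds`). Burungale–Flach, Camb. J. Math. 12 (2024), Cor. 2;
Tate (1974), Conjecture 4. [cite: BurungaleFlach2024, Cor. 2 (arXiv p. 4)] -/
theorem bsdTriple_of_j_mem_maximalCMJInvariants_of_L_one_ne_zero_of_BurungaleFlach2024
    (h : BurungaleFlach2024_bsd_rat) :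
    bsdTriple_of_j_mem_maximalCMJInvariants_of_L_one_ne_zero := by
  intro W _ _ hj hL
  obtain ⟨hfin, hsha, hformula⟩ := h W hj hL
  have hr : W.analyticRank = 0 := analyticRank_eq_zero_of_entireLFunction_one_ne_zero W hL
  have hΩ : (W.realPeriodRat : ℂ) ≠ 0 := by
    have hpos : 0 < W.realPeriodRat := W.realPeriodRat_pos_holds
    exact_mod_cast hpos.ne'
  refine ⟨bsdRankFormula_of_finite_point_of_entireLFunction_one_ne_zero W hfin hL, hsha, ?_⟩
  show W.leadingLCoeff = (W.bsdRHS : ℂ)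
  rw [W.leadingLCoeff_eq_of_analyticRank_eq_zero hr, W.bsdRHS_eq_of_finite,
    (div_eq_iff hΩ).1 hformula]
  push_cast
  ring

/-- **Converse bookkeeping (faithfulness check).** Corollary 2 over `ℚ` is recovered from
bsd.S28 (`bsdTriple_of_j_mem_maximalCMJInvariants_of_L_one_ne_zero`, hypothesis `h`) together
with the finiteness of `E(ℚ)` (`finite_point_of_j_mem_maximalCMJInvariants_of_L_one_ne_zero`,
Coates–Wiles 1977 Thm. 1 with Mordell–Weil, hypothesis `hCW`; needed because `rank_ℤ E(ℚ) = 0`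
alone does not make `E(ℚ)` finite without finite generation). Hence the vendored leaf
`BurungaleFlach2024_bsd_rat` is not stronger than the target plus a 1977 theorem.
Burungale–Flach (2024), Cor. 2; Coates–Wiles (1977), Thm. 1.
[cite: BurungaleFlach2024, Cor. 2 (arXiv p. 4)] [cite: CoatesWiles1977, Thm 1 (p. 223)] -/
theorem BurungaleFlach2024_bsd_rat_of_bsdTriple
    (hCW : finite_point_of_j_mem_maximalCMJInvariants_of_L_one_ne_zero)
    (h : bsdTriple_of_j_mem_maximalCMJInvariants_of_L_one_ne_zero) :
    BurungaleFlach2024_bsd_rat := by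
  intro W _ _ hj hL
  haveI hfin : Finite W.toAffine.Point := hCW W hj hL
  obtain ⟨-, hsha, hlead⟩ := h W hj hL
  have hr : W.analyticRank = 0 := analyticRank_eq_zero_of_entireLFunction_one_ne_zero W hL
  have hΩ : (W.realPeriodRat : ℂ) ≠ 0 := by
    have hpos : 0 < W.realPeriodRat := W.realPeriodRat_pos_holds
    exact_mod_cast hpos.ne'
  refine ⟨hfin, hsha, ?_⟩
  have hlead' : W.leadingLCoeff = (W.bsdRHS : ℂ) := hlead
  rw [W.leadingLCoeff_eq_of_analyticRank_eq_zero hr, W.bsdRHS_eq_of_finite] at hlead'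
  rw [hlead', div_eq_iff hΩ]
  push_cast
  ring

end Literature.NumberTheory.EllipticCurves

end
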